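import Summits.QuantumAdvantage.QuantumAdvantage.Theorems.LengthDialB

/-!
# LengthDial, part C/7 (§5–§6: THE LENGTH LAW `lengthLaw` and its `reach`; the grades Q/X/T/`WalkHardF` and their off-diagonal forms (R ⟺ R_off)) — support for item stmt-QuantumAdvantage-28401 (`Theses.AbsorptionDial.MassHiQuasi`)

Cell decomp-qadv, seat lens-5 («finite range + asymptotic regime + bridge»), generation 26 — land port of the node
«LengthDial» (published under the cell's HOME/decomp-qadv-lens-5/g26/LengthDial.lean, record NODE-g26.md; RESIDUAL MODE on
AbsorptionDial:28401 `MassHiQuasi`).  The node file with ONLY the namespace renamed `Theses.LengthDial → Theorems.LengthDial`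
and split at section boundaries into parts A–G (each importing the previous; part G alone imports the route file
Theses.AbsorptionDial for the BY-NAME equivalences and `closes`).  Prop-defs = the node's hardness predicates / grades only.
Tree facts reused by name, not restated: `RigidityLaws.walkExp_zero/self`, `RigidityLaws.ringWinU_congr_mod`,
`RigidityLaws.threeCharge`, `RigidityLaws.hasDegF_xor`, `FibreDial.const_of_hasDegF_zero`, `WalkCoreBasics.ringWinU_compl`, `chargeRecursion`, `sliceAt_mem_lowDeg`,
`Smolensky.comp_mem_lowDeg_of_coord`.  No `sorry`, no new axioms, no instances, no notation.
-/

set_option autoImplicit false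
set_option linter.unusedVariables false
set_option linter.dupNamespace false
set_option linter.style.longLine false

namespace Summit.QuantumAdvantage.QuantumAdvantage.Theorems.LengthDial

open Finset
open Summit.QuantumAdvantage.AdviceFreeQNC0
open Literature.Computability.MetaComplexity Literature.Computability.MetaComplexity.Smolensky

/-! ## §5 The length law and its reach -/

section Law
variable (p : ℕ) [Fact p.Prime]

/-- `(m, c)` is OFF-DIAGONAL: the end cuts `0` and `m` test different residues of `|u|`. -/
def OffDiag (m c : ℕ) : Prop := c % 3 ≠ m % 3

/-- hardness of the length-`m` game against cut degree `D`, value bound `θ`, ALL charges. -/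
def HardR (m D : ℕ) (θ : ℝ) : Prop :=
  ∀ c : ℕ, ∀ y : Fin (m + 1) → (Fin m → Bool) → Bool, (∀ g, HasDegF p (y g) D) →
    (winCount m c y : ℝ) ≤ θ * 2 ^ m

/-- the same, OFF-DIAGONAL charges only. -/
def OffHardR (m D : ℕ) (θ : ℝ) : Prop :=
  ∀ c : ℕ, OffDiag m c → ∀ y : Fin (m + 1) → (Fin m → Bool) → Bool, (∀ g, HasDegF p (y g) D) →
    (winCount m c y : ℝ) ≤ θ * 2 ^ m

variable {p}

/-- hardness at all charges gives off-diagonal hardness. -/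
theorem offHardR_of_hardR {m D : ℕ} {θ : ℝ} (h : HardR p m D θ) : OffHardR p m D θ :=
  fun c _ y hy => h c y hy

/-- off-diagonal hardness is antitone in the degree budget. -/
theorem offHardR_mono {m D D' : ℕ} {θ : ℝ} (h : OffHardR p m D' θ) (hD : D ≤ D') : OffHardR p m D θ :=
  fun c hc y hy => h c hc y fun g => hasDegF_mono (hy g) hD

/-- hardness is antitone in the degree budget. -/
theorem hardR_mono {m D D' : ℕ} {θ : ℝ} (h : HardR p m D' θ) (hD : D ≤ D') : HardR p m D θ :=
  fun c y hy => h c y fun g => hasDegF_mono (hy g) hD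

/-- off-diagonal hardness is monotone in the value bound `θ`. -/
theorem offHardR_mono_theta {m D : ℕ} {θ θ' : ℝ} (h : OffHardR p m D θ) (hθ : θ ≤ θ') : OffHardR p m D θ' :=
  fun c hc y hy => (h c hc y hy).trans (mul_le_mul_of_nonneg_right hθ (by positivity))

/-- **THE LENGTH LAW.** Off-diagonal hardness at lengths `k+1` and `k` against cut degree `5D`
gives hardness at length `k+2` for EVERY charge against cut degree `D`, with the larger of the two
value bounds. -/
theorem lengthLaw {k D : ℕ} {θ₀ θ₁ : ℝ} (h1 : OffHardR p (k + 1) (5 * D) θ₁)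
    (h0 : OffHardR p k (5 * D) θ₀) : HardR p (k + 2) D (max θ₀ θ₁) := by
  intro c y hy
  have face : ∀ b : Bool,
      ((if c1 c b % 3 ≠ (k + 1) % 3 then winCount (k + 1) (c1 c b) (peel1 c b y)
        else ∑ b' : Bool, winCount k (c2 c b b') (peel2 c b b' y) : ℕ) : ℝ)
        ≤ max θ₀ θ₁ * 2 ^ (k + 1) := by
    intro b
    split_ifs with hgood
    · have h := h1 (c1 c b) hgood (peel1 c b y) (hasDegF_peel1 c b hy)
      exact h.trans (mul_le_mul_of_nonneg_right (le_max_right _ _) (by positivity))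
    · push Not at hgood
      rw [Nat.cast_sum]
      have hb' : ∀ b' : Bool, (winCount k (c2 c b b') (peel2 c b b' y) : ℝ) ≤ θ₀ * 2 ^ k :=
        fun b' => h0 _ (c2_offDiag c k b b' hgood) _ (hasDegF_peel2 c b b' hy)
      calc ∑ b' : Bool, (winCount k (c2 c b b') (peel2 c b b' y) : ℝ)
          ≤ ∑ b' : Bool, θ₀ * 2 ^ k := Finset.sum_le_sum fun b' _ => hb' b'
        _ = θ₀ * 2 ^ (k + 1) := by rw [Finset.sum_const, Finset.card_univ, Fintype.card_bool]; ring
        _ ≤ max θ₀ θ₁ * 2 ^ (k + 1) := mul_le_mul_of_nonneg_right (le_max_left _ _) (by positivity)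
  rw [winCount_peel, Nat.cast_sum]
  calc ∑ b : Bool, ((if c1 c b % 3 ≠ (k + 1) % 3 then winCount (k + 1) (c1 c b) (peel1 c b y)
        else ∑ b' : Bool, winCount k (c2 c b b') (peel2 c b b' y) : ℕ) : ℝ)
      ≤ ∑ b : Bool, max θ₀ θ₁ * 2 ^ (k + 1) := Finset.sum_le_sum fun b _ => face b
    _ = max θ₀ θ₁ * 2 ^ (k + 2) := by rw [Finset.sum_const, Finset.card_univ, Fintype.card_bool]; ring

/-- the law with equal bounds. -/
theorem lengthLaw' {k D : ℕ} {θ : ℝ} (h1 : OffHardR p (k + 1) (5 * D) θ) (h0 : OffHardR p k (5 * D) θ) :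
    HardR p (k + 2) D θ := by
  simpa using lengthLaw h1 h0

/-- **REACH of a consecutive pair** (the lens's "how far must the finite range reach"): off-diagonal
hardness at lengths `m, m+1` against degree `5^s · D` certifies hardness (all charges) at each of the
next `s` lengths `m+2, …, m+s+1`, at degree `≥ D` (exactly `5^(s-1-t) · D` at `m+2+t`). -/
theorem reach {m D s : ℕ} {θ : ℝ} (hm : OffHardR p m (5 ^ s * D) θ) (hm1 : OffHardR p (m + 1) (5 ^ s * D) θ) :
    ∀ t, t < s → HardR p (m + 2 + t) (5 ^ (s - 1 - t) * D) θ := by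
  -- invariant: off-diagonal hardness at `m+t, m+t+1` against `5^(s-t) · D`
  have inv : ∀ t, t ≤ s →
      OffHardR p (m + t) (5 ^ (s - t) * D) θ ∧ OffHardR p (m + t + 1) (5 ^ (s - t) * D) θ := by
    intro t
    induction t with
    | zero => intro _; exact ⟨by simpa using hm, by simpa using hm1⟩
    | succ t ih =>
      intro ht
      obtain ⟨ha, hb⟩ := ih (Nat.le_of_succ_le ht)
      have hst : s - t = (s - (t + 1)) + 1 := by omega
      rw [hst, pow_succ, mul_comm (5 ^ (s - (t + 1))) 5, mul_assoc] at ha hb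
      have hc : HardR p (m + t + 2) (5 ^ (s - (t + 1)) * D) θ := lengthLaw' hb ha
      exact ⟨offHardR_mono hb (Nat.le_mul_of_pos_left _ (by norm_num)), offHardR_of_hardR hc⟩
  intro t ht
  obtain ⟨ha, hb⟩ := inv t ht.le
  have hst : s - t = (s - 1 - t) + 1 := by omega
  rw [hst, pow_succ, mul_comm (5 ^ (s - 1 - t)) 5, mul_assoc] at ha hb
  rw [show m + 2 + t = m + t + 2 by omega]
  exact lengthLaw' hb ha

end Law


/-! ## §6 The equivalences R ⟺ R_off at every grade, and `closes` -/

section Grades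

/-- `5 · (log₂ (k+2))^C ≤ (log₂ k)^(2C+3)` for `k ≥ 4`: one extra exponent pays for the peel. -/
theorem log_ineq (C k : ℕ) (hk : 4 ≤ k) : 5 * Nat.log 2 (k + 2) ^ C ≤ Nat.log 2 k ^ (2 * C + 3) := by
  set L := Nat.log 2 k with hL
  have hL2 : 2 ≤ L := Nat.le_log_of_pow_le (by norm_num) (by norm_num; omega)
  have hklt : k < 2 ^ (L + 1) := Nat.lt_pow_succ_log_self (by norm_num) k
  have hup : Nat.log 2 (k + 2) ≤ L + 1 := by
    have h2 : k + 2 < 2 ^ (L + 2) := by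
      have : 2 ≤ 2 ^ (L + 1) := by
        calc (2 : ℕ) = 2 ^ 1 := by norm_num
          _ ≤ 2 ^ (L + 1) := Nat.pow_le_pow_right (by norm_num) (by omega)
      calc k + 2 < 2 ^ (L + 1) + 2 ^ (L + 1) := by omega
        _ = 2 ^ (L + 2) := by ring
    have := Nat.log_lt_of_lt_pow (by omega) h2
    omega
  calc 5 * Nat.log 2 (k + 2) ^ C
      ≤ 5 * (2 * L) ^ C := Nat.mul_le_mul_left 5 (Nat.pow_le_pow_left (by omega) C)
    _ = 5 * 2 ^ C * L ^ C := by rw [mul_pow]; ring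
    _ ≤ 2 ^ (C + 3) * L ^ C := by
        apply Nat.mul_le_mul_right
        calc 5 * 2 ^ C ≤ 8 * 2 ^ C := by omega
          _ = 2 ^ (C + 3) := by ring
    _ ≤ L ^ (C + 3) * L ^ C := Nat.mul_le_mul_right _ (Nat.pow_le_pow_left hL2 _)
    _ = L ^ (2 * C + 3) := by rw [← pow_add]; congr 1; ring

/-- the quasi-polynomial value bound `1 − 2^{−(log₂ n)^A}` is monotone in `n`. -/
theorem theta_quasi_mono (A : ℕ) {a b : ℕ} (hab : a ≤ b) :
    (1 : ℝ) - 1 / (2 : ℝ) ^ (a ^ A) ≤ 1 - 1 / (2 : ℝ) ^ (b ^ A) := by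
  have h : (2 : ℝ) ^ (a ^ A) ≤ 2 ^ (b ^ A) := pow_le_pow_right₀ (by norm_num) (Nat.pow_le_pow_left hab A)
  have hpos : (0 : ℝ) < 2 ^ (a ^ A) := by positivity
  have := one_div_le_one_div_of_le hpos h
  linarith

/-- the inverse-polynomial value bound `1 − n^{−K}` is monotone in `n ≥ 1`. -/
theorem theta_poly_mono (K : ℕ) {a b : ℕ} (ha : 1 ≤ a) (hab : a ≤ b) :
    (1 : ℝ) - 1 / (a : ℝ) ^ K ≤ 1 - 1 / (b : ℝ) ^ K := by
  have h : (a : ℝ) ^ K ≤ (b : ℝ) ^ K := pow_le_pow_left₀ (by positivity) (by exact_mod_cast hab) K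
  have hpos : (0 : ℝ) < (a : ℝ) ^ K := by
    have : (0 : ℝ) < a := by exact_mod_cast ha
    positivity
  have := one_div_le_one_div_of_le hpos h
  linarith

/-! ### The Q grade: the residual item 28401 `MassHiQuasi` -/

/-- Q = WalkQuasiLossOdd (the consequent of `AbsorptionDial.MassHiQuasi`, verbatim). -/
def QuasiLoss : Prop :=
  ∀ (p : ℕ) [Fact p.Prime], 5 ≤ p → ∃ A : ℕ, ∀ C : ℕ, ∃ n₀ : ℕ, ∀ n ≥ n₀, ∀ c : ℕ,
    ∀ y : Fin (n + 1) → (Fin n → Bool) → Bool,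
    (∀ g, Summit.QuantumAdvantage.AdviceFreeQNC0.HasDegF p (y g) ((Nat.log 2 n) ^ C)) →
      ((Finset.univ.filter fun u : Fin n → Bool =>
        Summit.QuantumAdvantage.AdviceFreeQNC0.ringWinU c y u = true).card : ℝ)
        ≤ (1 - 1 / (2 : ℝ) ^ ((Nat.log 2 n) ^ A)) * (2 : ℝ) ^ n

/-- Q_off: the same, asked only at OFF-DIAGONAL charges `c % 3 ≠ n % 3`. -/
def QuasiLossOff : Prop :=
  ∀ (p : ℕ) [Fact p.Prime], 5 ≤ p → ∃ A : ℕ, ∀ C : ℕ, ∃ n₀ : ℕ, ∀ n ≥ n₀, ∀ c : ℕ, c % 3 ≠ n % 3 →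
    ∀ y : Fin (n + 1) → (Fin n → Bool) → Bool,
    (∀ g, Summit.QuantumAdvantage.AdviceFreeQNC0.HasDegF p (y g) ((Nat.log 2 n) ^ C)) →
      ((Finset.univ.filter fun u : Fin n → Bool =>
        Summit.QuantumAdvantage.AdviceFreeQNC0.ringWinU c y u = true).card : ℝ)
        ≤ (1 - 1 / (2 : ℝ) ^ ((Nat.log 2 n) ^ A)) * (2 : ℝ) ^ n

/-- the quarter floor (the antecedent of `AbsorptionDial.MassHiQuasi`, verbatim). -/
def QuarterFloor : Prop :=
  ∀ (p : ℕ) [Fact p.Prime], 5 ≤ p → ∀ C : ℕ, ∃ n₀ : ℕ, ∀ n ≥ n₀, ∀ c : ℕ,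
    ∀ y : Fin (n + 1) → (Fin n → Bool) → Bool,
    (∀ g, Summit.QuantumAdvantage.AdviceFreeQNC0.HasDegF p (y g) ((Nat.log 2 n) ^ C)) →
      2 ^ (Nat.sqrt (Nat.sqrt n)) ≤ (Finset.univ.filter fun u : Fin n → Bool =>
        Summit.QuantumAdvantage.AdviceFreeQNC0.ringWinU c y u = false).card

/-- THE PIECE: the residual with its conclusion asked only off the diagonal. -/
def MassHiQuasiOff : Prop := QuarterFloor → QuasiLossOff

/-- Q ⟹ Q_off (restriction to off-diagonal charges). -/
theorem quasiLossOff_of_quasiLoss (h : QuasiLoss) : QuasiLossOff := by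
  intro p _ hp
  obtain ⟨A, hA⟩ := h p hp
  refine ⟨A, fun C => ?_⟩
  obtain ⟨n₀, hn₀⟩ := hA C
  exact ⟨n₀, fun n hn c _ y hy => hn₀ n hn c y hy⟩

/-- **Q_off ⟹ Q** (the length law at the quasi grade; exponent `C ↦ 2C+3`). -/
theorem quasiLoss_of_off (h : QuasiLossOff) : QuasiLoss := by
  intro p _ hp
  obtain ⟨A, hA⟩ := h p hp
  refine ⟨A, fun C => ?_⟩
  obtain ⟨n₀, hn₀⟩ := hA (2 * C + 3)
  refine ⟨n₀ + 6, fun n hn c y hy => ?_⟩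
  obtain ⟨k, rfl⟩ : ∃ k, n = k + 2 := ⟨n - 2, by omega⟩
  have hk4 : 4 ≤ k := by omega
  have hdeg : 5 * Nat.log 2 (k + 2) ^ C ≤ Nat.log 2 k ^ (2 * C + 3) := log_ineq C k hk4
  have hdeg1 : 5 * Nat.log 2 (k + 2) ^ C ≤ Nat.log 2 (k + 1) ^ (2 * C + 3) :=
    hdeg.trans (Nat.pow_le_pow_left (Nat.log_mono_right (by omega)) _)
  have h1 : OffHardR p (k + 1) (5 * Nat.log 2 (k + 2) ^ C) (1 - 1 / (2 : ℝ) ^ (Nat.log 2 (k + 1) ^ A)) := by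
    intro c' hc' y' hy'
    have := hn₀ (k + 1) (by omega) c' hc' y' fun g => hasDegF_mono (hy' g) hdeg1
    simpa [winCount] using this
  have h0 : OffHardR p k (5 * Nat.log 2 (k + 2) ^ C) (1 - 1 / (2 : ℝ) ^ (Nat.log 2 k ^ A)) := by
    intro c' hc' y' hy'
    have := hn₀ k (by omega) c' hc' y' fun g => hasDegF_mono (hy' g) hdeg
    simpa [winCount] using this
  have hlaw := lengthLaw h1 h0 c y hy
  have hθ : max (1 - 1 / (2 : ℝ) ^ (Nat.log 2 k ^ A)) (1 - 1 / (2 : ℝ) ^ (Nat.log 2 (k + 1) ^ A))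
      ≤ 1 - 1 / (2 : ℝ) ^ (Nat.log 2 (k + 2) ^ A) :=
    max_le (theta_quasi_mono A (Nat.log_mono_right (by omega)))
      (theta_quasi_mono A (Nat.log_mono_right (by omega)))
  have := hlaw.trans (mul_le_mul_of_nonneg_right hθ (by positivity))
  simpa [winCount] using this

/-- **Q ⟺ Q_off** (the length law supplies the diagonal charges). -/
theorem quasiLoss_iff_off : QuasiLoss ↔ QuasiLossOff := ⟨quasiLossOff_of_quasiLoss, quasiLoss_of_off⟩

/-! ### The X grade: item 28487 `NoPerfectPolyOdd` (exactness) -/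

/-- X_off: no PERFECT polylog-degree strategy at off-diagonal charges. -/
def NoPerfectOff : Prop :=
  ∀ (p : ℕ) [Fact p.Prime], 5 ≤ p → ∀ C : ℕ, ∃ n₀ : ℕ, ∀ n ≥ n₀, ∀ c : ℕ, c % 3 ≠ n % 3 →
    ∀ y : Fin (n + 1) → (Fin n → Bool) → Bool,
    (∀ g, Summit.QuantumAdvantage.AdviceFreeQNC0.HasDegF p (y g) ((Nat.log 2 n) ^ C)) →
      ∃ u, Summit.QuantumAdvantage.AdviceFreeQNC0.ringWinU c y u = false

/-! ### The T grade: aside 26767 `WalkPolyLossOdd` (1/poly loss) -/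

/-- T_off. -/
def WalkPolyLossOff : Prop :=
  ∀ (p : ℕ) [Fact p.Prime], 5 ≤ p → ∀ C : ℕ, ∃ k n₀ : ℕ, ∀ n ≥ n₀, ∀ c : ℕ, c % 3 ≠ n % 3 →
    ∀ y : Fin (n + 1) → (Fin n → Bool) → Bool,
    (∀ g, Summit.QuantumAdvantage.AdviceFreeQNC0.HasDegF p (y g) ((Nat.log 2 n) ^ C)) →
      ((Finset.univ.filter fun u : Fin n → Bool =>
        Summit.QuantumAdvantage.AdviceFreeQNC0.ringWinU c y u = true).card : ℝ)
        ≤ (1 - 1 / (n : ℝ) ^ k) * (2 : ℝ) ^ n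

/-! ### The leaf crux grade: `WalkHardF p` (constant θ) -/

/-- `WalkHardF p` asked only off the diagonal. -/
def WalkHardFOff (p : ℕ) [Fact p.Prime] : Prop :=
  ∃ θ : ℝ, θ < 1 ∧ ∀ C : ℕ, ∃ n₀ : ℕ, ∀ n ≥ n₀, ∀ c : ℕ, c % 3 ≠ n % 3 →
    ∀ y : Fin (n + 1) → (Fin n → Bool) → Bool,
    (∀ g, HasDegF p (y g) ((Nat.log 2 n) ^ C)) →
      ((univ.filter fun u : Fin n → Bool => ringWinU c y u = true).card : ℝ) ≤ θ * (2 : ℝ) ^ n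

/-- **WalkHardF p ⟺ WalkHardFOff p** (every prime `p`; same `θ`). -/
theorem walkHardF_iff_off (p : ℕ) [Fact p.Prime] : WalkHardF p ↔ WalkHardFOff p := by
  constructor
  · rintro ⟨θ, hθ, h⟩
    refine ⟨θ, hθ, fun C => ?_⟩
    obtain ⟨n₀, hn₀⟩ := h C
    exact ⟨n₀, fun n hn c _ y hy => hn₀ n hn c y hy⟩
  · rintro ⟨θ, hθ, h⟩
    refine ⟨θ, hθ, fun C => ?_⟩
    obtain ⟨n₀, hn₀⟩ := h (2 * C + 3)
    refine ⟨n₀ + 6, fun n hn c y hy => ?_⟩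
    obtain ⟨k, rfl⟩ : ∃ k, n = k + 2 := ⟨n - 2, by omega⟩
    have hk4 : 4 ≤ k := by omega
    have hdeg : 5 * Nat.log 2 (k + 2) ^ C ≤ Nat.log 2 k ^ (2 * C + 3) := log_ineq C k hk4
    have hdeg1 : 5 * Nat.log 2 (k + 2) ^ C ≤ Nat.log 2 (k + 1) ^ (2 * C + 3) :=
      hdeg.trans (Nat.pow_le_pow_left (Nat.log_mono_right (by omega)) _)
    have h1 : OffHardR p (k + 1) (5 * Nat.log 2 (k + 2) ^ C) θ := by
      intro c' hc' y' hy'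
      have := hn₀ (k + 1) (by omega) c' hc' y' fun g => hasDegF_mono (hy' g) hdeg1
      simpa [winCount] using this
    have h0 : OffHardR p k (5 * Nat.log 2 (k + 2) ^ C) θ := by
      intro c' hc' y' hy'
      have := hn₀ k (by omega) c' hc' y' fun g => hasDegF_mono (hy' g) hdeg
      simpa [winCount] using this
    have hlaw := lengthLaw' h1 h0 c y hy
    simpa [winCount] using hlaw

end Grades

end Summit.QuantumAdvantage.QuantumAdvantage.Theorems.LengthDial
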